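import Literature.AnabelianGeometry.SemiGraphs.TemperedReconstructionCor39bOfImagesAt
import Literature.AnabelianGeometry.SemiGraphs.TemperedVerticialCharacterizationOfTopCyclic
import Literature.AnabelianGeometry.SemiGraphs.TemperedEdgeLikeDistinctOfTopCyclic
import Literature.AnabelianGeometry.SemiGraphs.TemperedEdgeLikeCentralizerOfTopCyclic
import Literature.AnabelianGeometry.SemiGraphs.MetabelianLeafStarCor39bTarget
import HarnessLib

/-!
# [SemiAnbd] Corollary 3.9 (b), up to twist, on the class TOP-CYCLIC — for ISOMORPHISMS, and for every compatibly
# quasi-geometric `φ` with non-commutative verticial images — Thm. 3.7 (iii)/(iv)-FREE on both sides; every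
# bicontinuous automorphism of `π₁^temp(𝒢⋆(p))` is graphic up to twist
# (row «COR39b-ISO@TOP-CYCLIC», file 3/3)

Mochizuki, *Semi-graphs of anabelioids*, Publ. RIMS **42** (2006), §3, Corollary 3.9 and its proof, manuscript
pp. 42–43 ("preserves verticial subgroups [cf. Theorem 3.7, (iv)] … induces a morphism on underlying
semi-graphs … arises from a morphism of semi-graphs of anabelioids"); Theorem 3.7 (iii)/(iv) pp. 40–41;
Remark 3.8.1 p. 42 ("any isomorphism of temperoids is quasi-geometric") [cite: MochizukiSemiAnbd2006, Cor 3.9 pp.42-43].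

PROOF-ONLY file (abc-iut cell, layer L3, seat abc-iut-L3-t10 gen 14; 0 definitions, no named fact; L3 lead gen 8
δ14 (2) GO; LF-SGA cell F-1710 / F-2771; inputs BY NAME: files 1–2 of the row, abc-iut-L3-t5 p503472
(`TemperedVerticialCharacterizationOfTopCyclic`: on TOP-CYCLIC an isomorphism of chart groups carries verticial
subgroups to verticial subgroups and nontrivial edge-like subgroups of closed edges to edge-like subgroups —
steps 1–2 of the printed proof of Cor. 3.9 (b) for isomorphisms, WITHOUT Thm. 3.7 (iii)/(iv)), abc-iut-f-172
(`edgeLikeCentralizerAt_of_topCyclic`, (R3c)), `compactInTwoVerticial_of_topCyclic` (Thm. 3.7 (iii) sentence 2),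
`edgeLikeDistinctAt_of_topCyclic`).

THE CLASS «TOP-CYCLIC»: countable graphs of anabelioids satisfying the hypotheses of Cor. 3.9 ALL of whose edge
groups are topologically cyclic — NO condition on the underlying graph (infinite valence, cores, rayless stars).  On
it the per-graph Thm. 3.7 (iii) `CompactInVerticialAt` and (iv) `MaximalCompactIffVerticialAt`, which the cell's
Cor-3.9 closers take on the side receiving `φ`, CAN FAIL (abc-iut-L3-t8: the rayless star `𝒢⋆(p)`), and clause
(b) itself FAILS there for a general compatibly quasi-geometric `φ` (this seat's `oneVertex_metabelianLeafStar_not_cor39b`: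
a fold with commutative image, p504509).  FOR ISOMORPHISMS, however, clause (b) HOLDS on the whole class:

* ★ `cor39b_upToTwist_baseAt_of_continuousMulEquiv_of_topCyclic` — **for top-cyclic Cor-3.9 graphs `G`, `H`,
  charts `c_G`, `c_H`, and ANY isomorphism of topological groups `e : π₁^temp(G) ≃ π₁^temp(H)`: `e` is induced up
  to twist by a LOCALLY OPEN morphism `F : G → H` (`∃ θ, B^temp(e) ≅ c_H⁻¹ ⋙ F^*_θ ⋙ c_G`), and `F.base` is UNIQUE**
  — file 2/3's `cor39b_upToTwist_baseAt_of_imagesAt` with the image data supplied by abc-iut-L3-t5's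
  `map_mem_verticialSubgroups_of_continuousMulEquiv_of_topCyclic` / `map_mem_edgeLikeSubgroups_…` (`e(K)`
  itself is the verticial / edge-like host, `e(K₁) ≠ e(H₁)` by injectivity), (R3c) by abc-iut-f-172, sentence 2 of
  Thm. 3.7 (iii) by `compactInTwoVerticial_of_topCyclic`, `EdgeLikeDistinctAt` by `edgeLikeDistinctAt_of_topCyclic`;
  named currency `…_inducesUpToTwist_…`; the two-sided form `…_and_symm_…` (`e⁻¹` is induced up to twist by a
  locally open `H → G`);
* ★ `metabelianLeafStar_cor39b_upToTwist_baseAt_of_continuousMulEquiv` — **every bicontinuous automorphism of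
  `π₁^temp(𝒢⋆(p))` (any two charts of the rayless star, every prime `p`) is GRAPHIC UP TO TWIST**: induced up to
  twist by a locally open endomorphism of `𝒢⋆(p)`, unique on the underlying semi-graph;
* ★ `metabelianLeafStar_cor39b_iso_and_not_cor39b_fold` — at the target `𝒢⋆(p)` clause (b) HOLDS for every
  isomorphism from a top-cyclic source and FAILS for the one-vertex fold (p504509): on the (iii)-side the dividing
  line is the homomorphism, not the pair;
* `forall_topCyclic_cor39b_of_continuousMulEquiv` — the ∀-form over the class, to be read against
  `not_forall_topCyclic_cor39b` (p504509): Thm. 3.7 (iii) at the target is necessary for general `φ`, NOT for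
  isomorphisms;
* ★ `cor39b_upToTwist_baseAt_of_topCyclic_of_forall_not_commutative` — BEYOND isomorphisms: on TOP-CYCLIC pairs
  clause (b) holds for EVERY compatibly quasi-geometric `φ` whose images of verticial subgroups are NON-COMMUTATIVE
  and whose images of edge-like subgroups are NONTRIVIAL (the maximal compact hosts of Def. 3.8 are then verticial by
  abc-iut-L3-t5's «verticial ⟺ maximal compact ∧ non-commutative», and the host of an edge image is edge-like once
  anchored, abc-iut-w6-d064) — the exact dividing line: the fold of p504509 has COMMUTATIVE image.

HONEST FRAMING: theorems about OUR typed tempered fundamental groups of OUR countable carriers; outside the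
[IUTchIII] Cor. 3.12 cone (every print consumer of Cor. 3.9 has a finite dual graph, where (b) is a theorem of the
finite files, `cor39CompatUpToTwistAt_of_finite`); print's Cor. 3.9 at finite `𝔾` untouched; nothing asserts abc
proved or refuted; no side is taken on [IUTchIII] Cor. 3.12; typed ≠ proved.
-/

noncomputable section

open CategoryTheory Topology

namespace Literature.AnabelianGeometry.SemiGraphs

namespace ProfiniteSemiGraph

universe u

variable {𝒢 ℋ : ProfiniteSemiGraph.{u}}

/-! ### An isomorphism maps every subgroup onto its image, open in itself -/

/-- An isomorphism of topological groups maps a subgroup ONTO its image, which is open in itself (the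
`MapsOntoOpenSubgroupOf` clause of Def. 3.8 for `e` and the host `e(K)`; cf. Rmk. 3.8.1).
[cite: MochizukiSemiAnbd2006, Rmk 3.8.1 p.42] -/
theorem mapsOntoOpenSubgroupOf_map_continuousMulEquiv {A B : Type u} [Group A] [TopologicalSpace A] [Group B]
    [TopologicalSpace B] (e : A ≃ₜ* B) (K : Subgroup A) :
    MapsOntoOpenSubgroupOf (e : A →ₜ* B).toMonoidHom K (K.map e.toMonoidHom) := by
  have hmap : K.map (e : A →ₜ* B).toMonoidHom = K.map e.toMonoidHom := rfl
  refine ⟨le_of_eq hmap, ?_⟩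
  have : (Subtype.val : K.map e.toMonoidHom → B) ⁻¹'
      ((K.map (e : A →ₜ* B).toMonoidHom : Subgroup B) : Set B) = Set.univ := by
    rw [hmap]
    exact Set.eq_univ_of_forall fun x => x.2
  rw [this]
  exact isOpen_univ

/-! ### Cor. 3.9 (b) for isomorphisms on the class TOP-CYCLIC -/

/-- ★ **[SemiAnbd] Cor. 3.9, clause (b), up to twist, for an ISOMORPHISM of chart groups between TOP-CYCLIC
graphs — Thm. 3.7 (iii)/(iv)-free on both sides.**  Let `G`, `H` be countable graphs of anabelioids satisfying
the hypotheses of Cor. 3.9, all of whose edge groups are topologically cyclic (any underlying graphs), `c_G`, `c_H`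
charts, and `e : π₁^temp(G) ≃ₜ* π₁^temp(H)` an isomorphism of topological groups.  Then `e` is induced up to twist
by a LOCALLY OPEN morphism of semi-graphs of anabelioids `F : G → H`, and the underlying morphism of semi-graphs of
any such `F` is unique.  Image data: abc-iut-L3-t5 (`e` carries verticial subgroups to verticial subgroups and
nontrivial edge-like subgroups of closed edges to edge-like subgroups; `e(K₁) ≠ e(H₁)` for `K₁ ≠ H₁`); target
inputs: (R3c) `edgeLikeCentralizerAt_of_topCyclic` (abc-iut-f-172), Thm. 3.7 (iii) sentence 2
`compactInTwoVerticial_of_topCyclic`, `edgeLikeDistinctAt_of_topCyclic`. [cite: MochizukiSemiAnbd2006, Cor 3.9 pp.42-43] -/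
theorem cor39b_upToTwist_baseAt_of_continuousMulEquiv_of_topCyclic
    (hcyc𝒢 : ∀ e : 𝒢.graph.Edge, ∃ t₀ : 𝒢.Ge e, (Subgroup.zpowers t₀).topologicalClosure = ⊤)
    (hcycℋ : ∀ e : ℋ.graph.Edge, ∃ t₀ : ℋ.Ge e, (Subgroup.zpowers t₀).topologicalClosure = ⊤)
    (h𝒢 : Cor39Hypotheses 𝒢) (hℋ : Cor39Hypotheses ℋ) (c𝒢 : TemperedPiChart 𝒢) (cℋ : TemperedPiChart ℋ)
    (e : c𝒢.G ≃ₜ* cℋ.G) :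
    ∃ F : Hom 𝒢 ℋ, F.IsLocallyOpen ∧
      (∃ θ : F.ConjugatorFamily, Nonempty (F.chartPullbackWith θ c𝒢 cℋ ≅ BTemp.res (e : c𝒢.G →ₜ* cℋ.G))) ∧
      ∀ F' : Hom 𝒢 ℋ, F'.IsLocallyOpen →
        (∃ θ' : F'.ConjugatorFamily,
          Nonempty (F'.chartPullbackWith θ' c𝒢 cℋ ≅ BTemp.res (e : c𝒢.G →ₜ* cℋ.G))) →
          F'.base = F.base := by
  have h𝒢37 := h𝒢.thm37Hypotheses
  have hℋ37 := hℋ.thm37Hypotheses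
  have hmap : ∀ K : Subgroup c𝒢.G, K.map (e : c𝒢.G →ₜ* cℋ.G).toMonoidHom = K.map e.toMonoidHom :=
    fun K => rfl
  refine cor39b_upToTwist_baseAt_of_imagesAt h𝒢 hℋ c𝒢 cℋ (edgeLikeCentralizerAt_of_topCyclic hℋ hcycℋ cℋ)
    (edgeLikeDistinctAt_of_topCyclic hcycℋ)
    (fun C hCc hC v₁ v₂ H₁ H₂ hH₁ hH₂ hne h₁ h₂ =>
      (ℋ.compactInTwoVerticial_of_topCyclic hℋ37 hcycℋ cℋ C hCc hC hH₁ hH₂ hne h₁ h₂).1)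
    (e : c𝒢.G →ₜ* cℋ.G) ?_ ?_ ?_
  · -- (himg): `e(K)` is verticial (abc-iut-L3-t5) and `K` maps onto it
    intro v K hK
    obtain ⟨w, hw⟩ :=
      map_mem_verticialSubgroups_of_continuousMulEquiv_of_topCyclic h𝒢37 hℋ37 hcyc𝒢 hcycℋ c𝒢 cℋ e hK
    exact ⟨w, K.map e.toMonoidHom, hw, mapsOntoOpenSubgroupOf_map_continuousMulEquiv e K⟩
  · -- (himgE): `e(L)` is edge-like at a closed edge (abc-iut-L3-t5) and `L` maps onto it
    intro e₀ L hL hLne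
    obtain ⟨e₁, -, he₁⟩ := map_mem_edgeLikeSubgroups_of_continuousMulEquiv_of_topCyclic h𝒢37 hℋ37 hcyc𝒢
      hcycℋ c𝒢 cℋ e (isClosedEdge_of_isGraph h𝒢.isGraph e₀) hL hLne
    exact ⟨e₁, L.map e.toMonoidHom, he₁, mapsOntoOpenSubgroupOf_map_continuousMulEquiv e L⟩
  · -- (hcompatV): distinct verticial subgroups have distinct verticial images
    intro v₁ v₂ K₁ H₁ hK₁ hH₁ hne _
    obtain ⟨u₁, hu₁⟩ :=
      map_mem_verticialSubgroups_of_continuousMulEquiv_of_topCyclic h𝒢37 hℋ37 hcyc𝒢 hcycℋ c𝒢 cℋ e hK₁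
    obtain ⟨u₂, hu₂⟩ :=
      map_mem_verticialSubgroups_of_continuousMulEquiv_of_topCyclic h𝒢37 hℋ37 hcyc𝒢 hcycℋ c𝒢 cℋ e hH₁
    exact ⟨u₁, u₂, K₁.map e.toMonoidHom, H₁.map e.toMonoidHom, hu₁, hu₂,
      fun h => hne (Subgroup.map_injective e.injective h), le_of_eq (hmap K₁), le_of_eq (hmap H₁)⟩

/-- The same in the named currency `Hom.InducesUpToTwist`. [cite: MochizukiSemiAnbd2006, Cor 3.9 pp.42-43] -/
theorem cor39b_inducesUpToTwist_of_continuousMulEquiv_of_topCyclic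
    (hcyc𝒢 : ∀ e : 𝒢.graph.Edge, ∃ t₀ : 𝒢.Ge e, (Subgroup.zpowers t₀).topologicalClosure = ⊤)
    (hcycℋ : ∀ e : ℋ.graph.Edge, ∃ t₀ : ℋ.Ge e, (Subgroup.zpowers t₀).topologicalClosure = ⊤)
    (h𝒢 : Cor39Hypotheses 𝒢) (hℋ : Cor39Hypotheses ℋ) (c𝒢 : TemperedPiChart 𝒢) (cℋ : TemperedPiChart ℋ)
    (e : c𝒢.G ≃ₜ* cℋ.G) :
    ∃ F : Hom 𝒢 ℋ, F.IsLocallyOpen ∧ F.InducesUpToTwist c𝒢 cℋ (e : c𝒢.G →ₜ* cℋ.G) ∧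
      ∀ F' : Hom 𝒢 ℋ, F'.IsLocallyOpen → F'.InducesUpToTwist c𝒢 cℋ (e : c𝒢.G →ₜ* cℋ.G) →
        F'.base = F.base :=
  cor39b_upToTwist_baseAt_of_continuousMulEquiv_of_topCyclic hcyc𝒢 hcycℋ h𝒢 hℋ c𝒢 cℋ e

/-- **Two-sided form**: both `e` and `e⁻¹` are induced up to twist by locally open morphisms `G → H`, `H → G`,
each unique on underlying semi-graphs. [cite: MochizukiSemiAnbd2006, Cor 3.9 pp.42-43] -/
theorem cor39b_inducesUpToTwist_and_symm_of_continuousMulEquiv_of_topCyclic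
    (hcyc𝒢 : ∀ e : 𝒢.graph.Edge, ∃ t₀ : 𝒢.Ge e, (Subgroup.zpowers t₀).topologicalClosure = ⊤)
    (hcycℋ : ∀ e : ℋ.graph.Edge, ∃ t₀ : ℋ.Ge e, (Subgroup.zpowers t₀).topologicalClosure = ⊤)
    (h𝒢 : Cor39Hypotheses 𝒢) (hℋ : Cor39Hypotheses ℋ) (c𝒢 : TemperedPiChart 𝒢) (cℋ : TemperedPiChart ℋ)
    (e : c𝒢.G ≃ₜ* cℋ.G) :
    (∃ F : Hom 𝒢 ℋ, F.IsLocallyOpen ∧ F.InducesUpToTwist c𝒢 cℋ (e : c𝒢.G →ₜ* cℋ.G) ∧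
      ∀ F' : Hom 𝒢 ℋ, F'.IsLocallyOpen → F'.InducesUpToTwist c𝒢 cℋ (e : c𝒢.G →ₜ* cℋ.G) →
        F'.base = F.base) ∧
    ∃ F : Hom ℋ 𝒢, F.IsLocallyOpen ∧ F.InducesUpToTwist cℋ c𝒢 (e.symm : cℋ.G →ₜ* c𝒢.G) ∧
      ∀ F' : Hom ℋ 𝒢, F'.IsLocallyOpen → F'.InducesUpToTwist cℋ c𝒢 (e.symm : cℋ.G →ₜ* c𝒢.G) →
        F'.base = F.base :=
  ⟨cor39b_inducesUpToTwist_of_continuousMulEquiv_of_topCyclic hcyc𝒢 hcycℋ h𝒢 hℋ c𝒢 cℋ e,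
    cor39b_inducesUpToTwist_of_continuousMulEquiv_of_topCyclic hcycℋ hcyc𝒢 hℋ h𝒢 cℋ c𝒢 e.symm⟩

/-- **The ∀-form over the class**: at EVERY pair of top-cyclic Cor-3.9 graphs and EVERY pair of charts, every
isomorphism of chart groups is induced up to twist by a locally open morphism — to be read against
`not_forall_topCyclic_cor39b` (this seat, p504509): for a GENERAL compatibly quasi-geometric `φ` the same ∀-form
is FALSE (Thm. 3.7 (iii) at the target is necessary there), for ISOMORPHISMS it holds with no Thm. 3.7 (iii)/(iv)
anywhere. [cite: MochizukiSemiAnbd2006, Cor 3.9 pp.42-43] -/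
theorem forall_topCyclic_cor39b_of_continuousMulEquiv :
    ∀ (𝒢 ℋ : ProfiniteSemiGraph.{u}),
      (∀ e : 𝒢.graph.Edge, ∃ t₀ : 𝒢.Ge e, (Subgroup.zpowers t₀).topologicalClosure = ⊤) →
      (∀ e : ℋ.graph.Edge, ∃ t₀ : ℋ.Ge e, (Subgroup.zpowers t₀).topologicalClosure = ⊤) →
        Cor39Hypotheses 𝒢 → Cor39Hypotheses ℋ →
        ∀ (c𝒢 : TemperedPiChart 𝒢) (cℋ : TemperedPiChart ℋ) (e : c𝒢.G ≃ₜ* cℋ.G),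
          ∃ F : Hom 𝒢 ℋ, F.IsLocallyOpen ∧ F.InducesUpToTwist c𝒢 cℋ (e : c𝒢.G →ₜ* cℋ.G) :=
  fun _ _ hcyc𝒢 hcycℋ h𝒢 hℋ c𝒢 cℋ e => by
    obtain ⟨F, hF, hind, -⟩ :=
      cor39b_inducesUpToTwist_of_continuousMulEquiv_of_topCyclic hcyc𝒢 hcycℋ h𝒢 hℋ c𝒢 cℋ e
    exact ⟨F, hF, hind⟩

/-! ### Beyond isomorphisms: compatibly quasi-geometric `φ` with NON-COMMUTATIVE verticial images -/

/-- ★ **Cor. 3.9 (b), up to twist, on TOP-CYCLIC pairs for every compatibly quasi-geometric `φ` whose verticial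
images are NON-COMMUTATIVE and whose edge-like images are NONTRIVIAL** — Thm. 3.7 (iii)/(iv)-free on both sides.
The dividing line on the class: by abc-iut-L3-t5 a maximal compact subgroup of `π₁^temp(H)` is verticial iff it is
non-commutative, so the maximal compact hosts of Def. 3.8 for `φ(K)`, `K` verticial, ARE verticial as soon as `φ(K)`
has two non-commuting elements (`hnc`), and the host `K₂ ⊓ H₂` of `φ(K₁ ⊓ H₁)` is edge-like once it is anchored by
the nontrivial `φ(K₁ ⊓ H₁)` (`hLne`; abc-iut-w6-d064's anchored theorem).  The one-vertex fold onto the exotic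
`⟨c⟩‾ ≅ ℤ_p` of `𝒢⋆(p)` (p504509) violates exactly `hnc`. [cite: MochizukiSemiAnbd2006, Cor 3.9 pp.42-43] -/
theorem cor39b_upToTwist_baseAt_of_topCyclic_of_forall_not_commutative
    (hcyc𝒢 : ∀ e : 𝒢.graph.Edge, ∃ t₀ : 𝒢.Ge e, (Subgroup.zpowers t₀).topologicalClosure = ⊤)
    (hcycℋ : ∀ e : ℋ.graph.Edge, ∃ t₀ : ℋ.Ge e, (Subgroup.zpowers t₀).topologicalClosure = ⊤)
    (h𝒢 : Cor39Hypotheses 𝒢) (hℋ : Cor39Hypotheses ℋ) (c𝒢 : TemperedPiChart 𝒢) (cℋ : TemperedPiChart ℋ)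
    (φ : c𝒢.G →ₜ* cℋ.G) (hφ : IsCompatiblyQuasiGeometric φ)
    (hnc : ∀ (v : 𝒢.graph.Vertex) (K : Subgroup c𝒢.G), K ∈ verticialSubgroups c𝒢 v →
      ∃ g₁ ∈ K, ∃ g₂ ∈ K, φ g₁ * φ g₂ ≠ φ g₂ * φ g₁)
    (hLne : ∀ (e₀ : 𝒢.graph.Edge) (L : Subgroup c𝒢.G), L ∈ edgeLikeSubgroups c𝒢 e₀ →
      L.map φ.toMonoidHom ≠ ⊥) :
    ∃ F : Hom 𝒢 ℋ, F.IsLocallyOpen ∧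
      (∃ θ : F.ConjugatorFamily, Nonempty (F.chartPullbackWith θ c𝒢 cℋ ≅ BTemp.res φ)) ∧
      ∀ F' : Hom 𝒢 ℋ, F'.IsLocallyOpen →
        (∃ θ' : F'.ConjugatorFamily, Nonempty (F'.chartPullbackWith θ' c𝒢 cℋ ≅ BTemp.res φ)) →
          F'.base = F.base := by
  have h𝒢37 := h𝒢.thm37Hypotheses
  have hℋ37 := hℋ.thm37Hypotheses
  have hvm𝒢 := hvm_of_topCyclic h𝒢 hcyc𝒢 c𝒢
  -- a maximal compact subgroup of `π₁^temp(H)` containing the image of a verticial subgroup is verticial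
  have hvert : ∀ (v : 𝒢.graph.Vertex) (K : Subgroup c𝒢.G), K ∈ verticialSubgroups c𝒢 v →
      ∀ K₂ : Subgroup cℋ.G, IsMaximalCompactSubgroup K₂ → K.map φ.toMonoidHom ≤ K₂ →
        ∃ w : ℋ.graph.Vertex, K₂ ∈ verticialSubgroups cℋ w := by
    intro v K hK K₂ hK₂ hle
    obtain ⟨g₁, hg₁, g₂, hg₂, hg⟩ := hnc v K hK
    exact (exists_mem_verticialSubgroups_iff_isMaximalCompactSubgroup_and_not_commutative_of_topCyclic hℋ37
      hcycℋ cℋ K₂).mpr ⟨hK₂, φ g₁, hle ⟨g₁, hg₁, rfl⟩, φ g₂, hle ⟨g₂, hg₂, rfl⟩, hg⟩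
  -- (himg)
  have himg : ∀ (v : 𝒢.graph.Vertex) (K : Subgroup c𝒢.G), K ∈ verticialSubgroups c𝒢 v →
      ∃ (w : ℋ.graph.Vertex) (K₂ : Subgroup cℋ.G), K₂ ∈ verticialSubgroups cℋ w ∧
        MapsOntoOpenSubgroupOf φ.toMonoidHom K K₂ := by
    intro v K hK
    obtain ⟨K₂, hK₂, hmaps⟩ := hφ.isQuasiGeometric.maximal K (hvm𝒢 v K hK)
    obtain ⟨w, hw⟩ := hvert v K hK K₂ hK₂ hmaps.1
    exact ⟨w, K₂, hw, hmaps⟩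
  refine cor39b_upToTwist_baseAt_of_imagesAt h𝒢 hℋ c𝒢 cℋ (edgeLikeCentralizerAt_of_topCyclic hℋ hcycℋ cℋ)
    (edgeLikeDistinctAt_of_topCyclic hcycℋ)
    (fun C hCc hC v₁ v₂ H₁ H₂ hH₁ hH₂ hne h₁ h₂ =>
      (ℋ.compactInTwoVerticial_of_topCyclic hℋ37 hcycℋ cℋ C hCc hC hH₁ hH₂ hne h₁ h₂).1)
    φ himg ?_ ?_
  · -- (himgE): the host `K₂ ⊓ H₂` of Def. 3.8 is anchored by `φ(L) ≠ 1`, hence edge-like (abc-iut-w6-d064)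
    intro e₀ L hL hL0
    obtain ⟨v₁, v₂, K₁, H₁, hK₁v, hH₁v, hne, rfl⟩ :=
      edgeLikeIsInfVerticialAt_holds 𝒢 h𝒢37 c𝒢 e₀ (isClosedEdge_of_isGraph h𝒢.isGraph e₀) L hL hL0
    obtain ⟨K₂, H₂, hK₂, hH₂, hne₂, hnt₂, hmaps⟩ :=
      hφ.isQuasiGeometric.inter K₁ H₁ (hvm𝒢 v₁ K₁ hK₁v) (hvm𝒢 v₂ H₁ hH₁v) hne hL0
    -- a verticial host `W` of `φ(K₁)` anchors `K₂`
    obtain ⟨w, W, hW, hmapsW⟩ := himg v₁ K₁ hK₁v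
    have hanch : K₂ ⊓ W ≠ ⊥ := by
      intro h0
      apply hLne e₀ (K₁ ⊓ H₁) hL
      refine le_bot_iff.mp (h0 ▸ le_inf (hmaps.1.trans inf_le_left) ?_)
      exact (Subgroup.map_mono inf_le_left).trans hmapsW.1
    obtain ⟨e₁, -, hmem⟩ := ℋ.exists_mem_edgeLikeSubgroups_of_maximalCompact_inf_of_anchored_of_topCyclic hℋ37
      hcycℋ cℋ hK₂ hH₂ hne₂ hnt₂ hW hanch
    exact ⟨e₁, K₂ ⊓ H₂, hmem, hmaps⟩
  · -- (hcompatV): the two hosts of the compat clause are non-commutative, hence verticial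
    intro v₁ v₂ K₁ H₁ hK₁ hH₁ hne hmeet
    obtain ⟨K₂, H₂, hK₂, hH₂, hne₂, hle₁, hle₂⟩ :=
      hφ.compat K₁ H₁ (hvm𝒢 v₁ K₁ hK₁) (hvm𝒢 v₂ H₁ hH₁) hne hmeet
    obtain ⟨u₁, hu₁⟩ := hvert v₁ K₁ hK₁ K₂ hK₂ hle₁
    obtain ⟨u₂, hu₂⟩ := hvert v₂ H₁ hH₁ H₂ hH₂ hle₂
    exact ⟨u₁, u₂, K₂, H₂, hu₁, hu₂, hne₂, hle₁, hle₂⟩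

/-! ### The rayless star `𝒢⋆(p)`: every bicontinuous automorphism of `π₁^temp` is graphic up to twist -/

section Star

variable (p : ℕ) [hp : Fact p.Prime]

/-- ★ **Every bicontinuous automorphism of `π₁^temp(𝒢⋆(p))` is GRAPHIC UP TO TWIST** (rayless star of
abc-iut-L3-t8, every prime `p`, ANY two charts `c`, `c'`; hypothesis-free): an isomorphism of topological groups
`e : c.G ≃ₜ* c'.G` is induced up to twist by a locally open morphism `F : 𝒢⋆(p) → 𝒢⋆(p)`, unique on the underlying
semi-graph — although at `𝒢⋆(p)` Thm. 3.7 (iii) and (iv) FAIL and clause (b) FAILS for the one-vertex fold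
(p504509).  The exotic maximal compact subgroups (`⟨c⟩‾ ≅ ℤ_p`, commutative) are permuted among themselves by `e`
(abc-iut-L3-t8 p500569) and never host the image of a verticial subgroup. [cite: MochizukiSemiAnbd2006, Cor 3.9 pp.42-43] -/
theorem metabelianLeafStar_cor39b_upToTwist_baseAt_of_continuousMulEquiv
    (c c' : TemperedPiChart (metabelianLeafStar p)) (e : c.G ≃ₜ* c'.G) :
    ∃ F : Hom (metabelianLeafStar p) (metabelianLeafStar p), F.IsLocallyOpen ∧
      (∃ θ : F.ConjugatorFamily, Nonempty (F.chartPullbackWith θ c c' ≅ BTemp.res (e : c.G →ₜ* c'.G))) ∧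
      ∀ F' : Hom (metabelianLeafStar p) (metabelianLeafStar p), F'.IsLocallyOpen →
        (∃ θ' : F'.ConjugatorFamily,
          Nonempty (F'.chartPullbackWith θ' c c' ≅ BTemp.res (e : c.G →ₜ* c'.G))) →
          F'.base = F.base :=
  cor39b_upToTwist_baseAt_of_continuousMulEquiv_of_topCyclic (metabelianLeafStar_topCyclic p)
    (metabelianLeafStar_topCyclic p) (metabelianLeafStar_cor39Hypotheses p) (metabelianLeafStar_cor39Hypotheses p)
    c c' e

/-- ★ **At the target `𝒢⋆(p)`, clause (b) of Cor. 3.9 up to twist HOLDS for every ISOMORPHISM from a top-cyclic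
Cor-3.9 source (every pair of charts) and FAILS for the one-vertex fold onto the exotic maximal compact subgroup**
(this seat's `oneVertex_metabelianLeafStar_not_cor39b`, p504509): on the Thm-3.7-(iii)-side of the cell the
dividing line runs between homomorphisms, not between pairs of graphs. [cite: MochizukiSemiAnbd2006, Cor 3.9 pp.42-43] -/
theorem metabelianLeafStar_cor39b_iso_and_not_cor39b_fold :
    (∀ (𝒦 : ProfiniteSemiGraph.{0}),
      (∀ e : 𝒦.graph.Edge, ∃ t₀ : 𝒦.Ge e, (Subgroup.zpowers t₀).topologicalClosure = ⊤) → Cor39Hypotheses 𝒦 →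
        ∀ (c𝒦 : TemperedPiChart 𝒦) (c : TemperedPiChart (metabelianLeafStar p)) (e : c𝒦.G ≃ₜ* c.G),
          ∃ F : Hom 𝒦 (metabelianLeafStar p), F.IsLocallyOpen ∧
            F.InducesUpToTwist c𝒦 c (e : c𝒦.G →ₜ* c.G) ∧
            ∀ F' : Hom 𝒦 (metabelianLeafStar p), F'.IsLocallyOpen →
              F'.InducesUpToTwist c𝒦 c (e : c𝒦.G →ₜ* c.G) → F'.base = F.base) ∧
    ∀ c : TemperedPiChart (metabelianLeafStar p), ∃ c𝒱 : TemperedPiChart (OneVertex.graph (FreeProPRankTwo.Grp p)),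
      ¬ ∀ φ : c𝒱.G →ₜ* c.G, IsCompatiblyQuasiGeometric φ →
        ∃ F : Hom (OneVertex.graph (FreeProPRankTwo.Grp p)) (metabelianLeafStar p), F.IsLocallyOpen ∧
          F.InducesUpToTwist c𝒱 c φ :=
  ⟨fun _ hcyc𝒦 h𝒦 c𝒦 c e => cor39b_inducesUpToTwist_of_continuousMulEquiv_of_topCyclic hcyc𝒦
      (metabelianLeafStar_topCyclic p) h𝒦 (metabelianLeafStar_cor39Hypotheses p) c𝒦 c e,
    fun c => oneVertex_metabelianLeafStar_not_cor39b p c⟩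

end Star

end ProfiniteSemiGraph

end Literature.AnabelianGeometry.SemiGraphs

end
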